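import Mathlib
import Summits.Ventures.PercRepro2.HCov
import Summits.Ventures.PercRepro2.RootLeafUSigns
import Summits.Ventures.PercRepro2.RootLeafUSecond
import Summits.Ventures.PercRepro2.RootLeafUHalf

/-!
# (G4-u): the `o ∈ K` half of the second coefficient, `T2oK`, in the exploration of `K = C(a₂)`
(blind cell PercRepro2, p4 g13; S3 v55 item (aa); no definitions, every mass written out)

Conventions of RootLeafUHalf: the instance `a₁ := u` on `G₁` (roots `u, a₂`; `L = C(u)`, `K = C(a₂)`,
`Q = {u ↮ a₂}`, `PD = Q ∩ {c ∉ L ∪ K}`, `T′ = Q ∩ {c ∈ L}`, `D = P(PD)`, `t′ = P(T′)`,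
`d0 = P(c ∉ K)`, `e0 = P(c ∉ K, o ∈ K)`, `hb = P(b ∈ K)`, `S = P(Ω)`); the world
`Q ∩ {c ∉ K} = PD ⊔ T′` of mass `P₀ = D + t′`, its `o ∈ K` part `P_o = P(PD, oK) + P(T′, oK)`;
`A = α + κ`, `β = S·D + d0·Z` the constants of RootLeafUHalf (`α = D·hb + d0·gap`,
`κ = S(EQb3 + PDb) + hb(EQ3 + Z) − (S − d0)·gap`).

**The master identity** (`P0_mul_T2oK_eq`, a ring identity after the splits `Q = PD ⊔ T ⊔ T′`):

  `P₀·T2oK = A·ℋ′ + 2β·X_b + ℰ·(e0·P₀ − d0·P_o)`,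

* `ℋ′ = t′·P(PD, oK) − D·P(T′, oK) ≥ 0` (`HoK_nonneg`) — half of the `o ∈ K` part of the margin `ℋ`
  of RootLeafUSecond; BHK06 Thm 1.4 at the root-swapped instance (`ToL_mul_D_le p hp ends o a₂ u c`):
  the cross-cluster slack `P₀²·Cov'(1_{c∉L}, 1_{oK})` under `P' = P(· | u, c ∉ K)`;
* `X_b = P(T′, bK, oK)·P₀ − P(T′, bK)·P_o − [P(PD, bL, oK) + P(T′, bL, oK)]·P₀ + [P(PD, bL) + P(T′, bL)]·P_o`
  `= P₀²·Cov'(1_{T′}·1_{bK} − 1_{bL}, 1_{oK})` — the ONLY unsigned term (the `b`-functional);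
* `ℰ ≥ 0` (`Ee_nonneg`, RootLeafUSecond) and `e0·P₀ − d0·P_o = P(c∉K)·P(oK, uK, c∉K) − P(oK, c∉K)·P(uK, c∉K)
  ≥ 0` (`e0P0_sub_d0Po_nonneg`, BHK06 Thm 1.3 at `a₂` avoiding `c`: `{o ∈ K}`, `{u ∈ K}` positively
  correlated).

Hence **`T2oK_nonneg_of_mixK`**: the single inequality

  **(MIX-K)** `0 ≤ A·ℋ′ + 2β·X_b`, i.e. `Cov'(1_{c∈L}·(1_{b∈K} − A/(2β)) − 1_{b∈L}, 1_{o∈K}) ≥ 0`,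

implies `0 ≤ T2oK` (the `o ∈ K` half of W1 = `0 ≤ T2`).  In the same world
`ℋ′ = P₀²·Cov'(1_{c∉L}, 1_{oK}) ≥ 0` and `−Cov'(1_{bL}, 1_{oK}) ≥ 0` are BHK 1.4 facts, so (MIX-K) is
exactly a bound on the MIXED covariance `Cov'(1_{c∈L}·1_{b∈K}, 1_{o∈K})` (census: 0 violations on
≈ 3,000 instances n = 5–8, three palettes; TIGHT on the family «b a leaf at a₂», where
`A = 2β·p_b` and (MIX-K) is an equality).  Conditional theorem: (MIX-K) is census-true and
unproved; with `T2oL_nonneg_of_MULT` (RootLeafUMult) the two halves of W1 are each reduced to one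
explicit covariance inequality of the same shape (`(MULT)` in the `L`-exploration, (MIX-K) in the
`K`-exploration).
-/

namespace Summit.Ventures.PercRepro2

open UnionCluster CovForm

namespace RootLeafU

namespace MixK

variable {V : Type*} {E : Type*} [Fintype E] [DecidableEq E] [Fintype V] [DecidableEq V]
  {R : Type*} [Field R] [LinearOrder R] [IsStrictOrderedRing R]

section Identity

variable (p : E → R) (ends : E → Sym2 V) (o a₂ c b u : V)

omit [Fintype V] in
/-- **The master identity** (no definitions — the masses are written out):
`P₀·T2oK = A·ℋ′ + 2β·X_b + ℰ·(e0·P₀ − d0·P_o)` with `P₀ = D + t′`, `P_o = P(PD,oK) + P(T′,oK)`,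
`ℋ′ = t′·P(PD,oK) − D·P(T′,oK)` (`= ℋ^{oK}/2`), `A = α + κ`, `β = S·D + d0·Z` (RootLeafUHalf) and
`X_b = P(T′,bK,oK)·P₀ − P(T′,bK)·P_o − [P(PD,bL,oK) + P(T′,bL,oK)]·P₀ + [P(PD,bL) + P(T′,bL)]·P_o`. -/
theorem P0_mul_T2oK_eq :
    (prob p (PDEvent ends u a₂ c) + prob p (TEvent ends a₂ u c)) * T2oK p ends o a₂ c b u =
      ((prob p (PDEvent ends u a₂ c) * prob p (connEvent ends a₂ b) + prob p (avoidAll ends a₂ {c}) * gap p ends u a₂ b) + (prob p Set.univ * EQb3 p ends u a₂ c b + prob p Set.univ * PDb p ends u a₂ c b + prob p (connEvent ends a₂ b) * EQ3 p ends u a₂ c + prob p (connEvent ends a₂ b) * prob p (avoidAll ends a₂ {u}) - (prob p Set.univ - prob p (avoidAll ends a₂ {c})) * gap p ends u a₂ b)) * (prob p (TEvent ends a₂ u c) * prob p (PDEvent ends u a₂ c ∩ connEvent ends a₂ o) - prob p (PDEvent ends u a₂ c) * prob p (TEvent ends a₂ u c ∩ connEvent ends a₂ o)) +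
        2 * (prob p Set.univ * prob p (PDEvent ends u a₂ c) + prob p (avoidAll ends a₂ {c}) * prob p (avoidAll ends a₂ {u})) * (prob p (TEvent ends a₂ u c ∩ (connEvent ends a₂ o ∩ connEvent ends a₂ b)) * (prob p (PDEvent ends u a₂ c) + prob p (TEvent ends a₂ u c)) - prob p (TEvent ends a₂ u c ∩ connEvent ends a₂ b) * (prob p (PDEvent ends u a₂ c ∩ connEvent ends a₂ o) + prob p (TEvent ends a₂ u c ∩ connEvent ends a₂ o)) - (prob p (PDEvent ends u a₂ c ∩ (connEvent ends a₂ o ∩ connEvent ends u b)) + prob p (TEvent ends a₂ u c ∩ (connEvent ends a₂ o ∩ connEvent ends u b))) * (prob p (PDEvent ends u a₂ c) + prob p (TEvent ends a₂ u c)) + (prob p (PDEvent ends u a₂ c ∩ connEvent ends u b) + prob p (TEvent ends a₂ u c ∩ connEvent ends u b)) * (prob p (PDEvent ends u a₂ c ∩ connEvent ends a₂ o) + prob p (TEvent ends a₂ u c ∩ connEvent ends a₂ o))) +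
        Ee p ends a₂ c b u * (prob p (avoidAll ends a₂ {c} ∩ connEvent ends a₂ o) * (prob p (PDEvent ends u a₂ c) + prob p (TEvent ends a₂ u c)) - prob p (avoidAll ends a₂ {c}) * (prob p (PDEvent ends u a₂ c ∩ connEvent ends a₂ o) + prob p (TEvent ends a₂ u c ∩ connEvent ends a₂ o))) := by
  unfold T2oK Ee EQb3 PDb EQ3
  rw [gap_eq_Q p ends u a₂ b, Qsplit_univ p ends u a₂ c, Qsplit p ends u a₂ c (connEvent ends a₂ b),
    Qsplit p ends u a₂ c (connEvent ends u b)]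
  ring

end Identity

section Signs

variable (p : E → R) (ends : E → Sym2 V) (o a₂ c b u : V)

omit [Fintype E] [DecidableEq E] [Fintype V] [DecidableEq V] in
/-- `T ∩ X = (Q ∩ X) ∩ {a₂ ↔ c}` (`T = TEvent u a₂ c = Q ∩ {c ∈ K}`). -/
lemma TEvent_ua2_inter_eq (X : Set (Config E)) :
    TEvent ends u a₂ c ∩ X = avoidAll ends a₂ {u} ∩ X ∩ connEvent ends a₂ c := by
  unfold TEvent
  rw [avoidAll_singleton_eq]
  ext ω
  simp only [Set.mem_inter_iff, Set.mem_compl_iff]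
  tauto

omit [Fintype V] [LinearOrder R] [IsStrictOrderedRing R] in
/-- `P(PD ∩ X) + P(T′ ∩ X) = P(Q ∩ X ∩ {c ∉ K})`: the world `Q ∩ {c ∉ K} = PD ⊔ T′`. -/
lemma prob_PD_add_Tp (X : Set (Config E)) :
    prob p (PDEvent ends u a₂ c ∩ X) + prob p (TEvent ends a₂ u c ∩ X) =
      prob p (avoidAll ends a₂ {u} ∩ X ∩ (connEvent ends a₂ c)ᶜ) := by
  have h1 := Qsplit p ends u a₂ c X
  have h2 := prob_inter_add_prob_inter_compl p (avoidAll ends a₂ {u} ∩ X) (connEvent ends a₂ c)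
  rw [← TEvent_ua2_inter_eq ends a₂ c u X] at h2
  linear_combination -h1 - h2

omit [Fintype V] [LinearOrder R] [IsStrictOrderedRing R] in
/-- `P₀ = P(Q, c ∉ K)`. -/
lemma P0_eq : prob p (PDEvent ends u a₂ c) + prob p (TEvent ends a₂ u c) =
    prob p (avoidAll ends a₂ {u} ∩ (connEvent ends a₂ c)ᶜ) := by
  have h := prob_PD_add_Tp p ends a₂ c u Set.univ
  simpa only [Set.inter_univ] using h

omit [Fintype V] [LinearOrder R] [IsStrictOrderedRing R] in
/-- `P_o = P(Q, oK, c ∉ K)`. -/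
lemma Po_eq :
    prob p (PDEvent ends u a₂ c ∩ connEvent ends a₂ o) + prob p (TEvent ends a₂ u c ∩ connEvent ends a₂ o) =
      prob p (avoidAll ends a₂ {u} ∩ connEvent ends a₂ o ∩ (connEvent ends a₂ c)ᶜ) :=
  prob_PD_add_Tp p ends a₂ c u (connEvent ends a₂ o)

omit [Fintype E] [DecidableEq E] [Fintype V] [DecidableEq V] in
/-- `Q ∩ {o ∈ K} ∩ {c ∉ K} = ({o ∈ K} ∩ {c ∉ K}) ∖ ({u ∈ K} ∩ {c ∉ K})` (BHK06 Thm 1.3 form). -/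
lemma Q_inter_a2o_inter_compl_eq :
    avoidAll ends a₂ {u} ∩ connEvent ends a₂ o ∩ (connEvent ends a₂ c)ᶜ =
      (connEvent ends a₂ o ∩ (connEvent ends a₂ c)ᶜ) ∩ (connEvent ends a₂ u ∩ (connEvent ends a₂ c)ᶜ)ᶜ := by
  rw [avoidAll_singleton_eq]
  ext ω
  simp only [Set.mem_inter_iff, Set.mem_compl_iff, not_and, not_not]
  tauto

omit [Fintype E] [DecidableEq E] [Fintype V] [DecidableEq V] in
/-- `Q ∩ {c ∉ K} = {c ∉ K} ∖ ({u ∈ K} ∩ {c ∉ K})` (BHK06 Thm 1.3 form). -/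
lemma Q_inter_compl_eq :
    avoidAll ends a₂ {u} ∩ (connEvent ends a₂ c)ᶜ =
      (connEvent ends a₂ c)ᶜ ∩ (connEvent ends a₂ u ∩ (connEvent ends a₂ c)ᶜ)ᶜ := by
  rw [avoidAll_singleton_eq]
  ext ω
  simp only [Set.mem_inter_iff, Set.mem_compl_iff, not_and, not_not]
  tauto

/-- **BHK06 Thm 1.3 at `a₂` avoiding `c`**: `0 ≤ e0·P₀ − d0·P_o`, i.e.
`P(oK, c∉K)·P(u∉K, c∉K) ≥ P(c∉K)·P(oK, u∉K, c∉K)` (`{o ∈ K}`, `{u ∈ K}` positively correlated given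
`c ∉ K`). -/
theorem e0P0_sub_d0Po_nonneg (hp : IsProbVec p) :
    0 ≤ prob p (avoidAll ends a₂ {c} ∩ connEvent ends a₂ o) * (prob p (PDEvent ends u a₂ c) + prob p (TEvent ends a₂ u c)) - prob p (avoidAll ends a₂ {c}) * (prob p (PDEvent ends u a₂ c ∩ connEvent ends a₂ o) + prob p (TEvent ends a₂ u c ∩ connEvent ends a₂ o)) := by
  have h13 := bhk_same_cluster_events p hp ends a₂ c (ExploreA3.isUpperSet_mem o)
    (ExploreA3.isUpperSet_mem u)
  simp only [ExploreA3.clusterInEvent_mem_eq] at h13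
  -- `P(oK, c∉K) = P(oK, uK, c∉K) + P(oK, u∉K, c∉K)`, `P(c∉K) = P(uK, c∉K) + P(u∉K, c∉K)`
  have ho := prob_inter_add_prob_inter_compl p (connEvent ends a₂ o ∩ (connEvent ends a₂ c)ᶜ)
    (connEvent ends a₂ u ∩ (connEvent ends a₂ c)ᶜ)
  have hc := prob_inter_add_prob_inter_compl p (connEvent ends a₂ c)ᶜ
    (connEvent ends a₂ u ∩ (connEvent ends a₂ c)ᶜ)
  rw [P0_eq, Po_eq, Q_inter_a2o_inter_compl_eq, Q_inter_compl_eq, avoidAll_singleton_eq ends a₂ c]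
  have e1 : connEvent ends a₂ o ∩ (connEvent ends a₂ c)ᶜ ∩ (connEvent ends a₂ u ∩ (connEvent ends a₂ c)ᶜ) =
      connEvent ends a₂ o ∩ connEvent ends a₂ u ∩ (connEvent ends a₂ c)ᶜ := by
    ext ω
    simp only [Set.mem_inter_iff, Set.mem_compl_iff]
    tauto
  have e2 : (connEvent ends a₂ c)ᶜ ∩ (connEvent ends a₂ u ∩ (connEvent ends a₂ c)ᶜ) =
      connEvent ends a₂ u ∩ (connEvent ends a₂ c)ᶜ := by
    ext ω
    simp only [Set.mem_inter_iff, Set.mem_compl_iff]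
    tauto
  rw [e1] at ho
  rw [e2] at hc
  rw [Set.inter_comm (connEvent ends a₂ c)ᶜ (connEvent ends a₂ o)]
  have hY : prob p ((connEvent ends a₂ c)ᶜ ∩ (connEvent ends a₂ u ∩ (connEvent ends a₂ c)ᶜ)ᶜ) =
      prob p (connEvent ends a₂ c)ᶜ - prob p (connEvent ends a₂ u ∩ (connEvent ends a₂ c)ᶜ) := by
    linarith
  have hW : prob p (connEvent ends a₂ o ∩ (connEvent ends a₂ c)ᶜ ∩
        (connEvent ends a₂ u ∩ (connEvent ends a₂ c)ᶜ)ᶜ) =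
      prob p (connEvent ends a₂ o ∩ (connEvent ends a₂ c)ᶜ) -
        prob p (connEvent ends a₂ o ∩ connEvent ends a₂ u ∩ (connEvent ends a₂ c)ᶜ) := by
    linarith
  rw [hY, hW]
  nlinarith [h13]

/-- **`0 ≤ ℋ′ = t′·P(PD, oK) − D·P(T′, oK)`** (`ℋ^{oK}/2`, the `o ∈ K` part of the margin `ℋ`): BHK06
Thm 1.4 at `(a₂, u)` avoiding `{u, c}` (`ToL_mul_D_le` at the root-swapped instance) — the cross-cluster
slack `Cov'(1_{c∉L}, 1_{oK}) ≥ 0` under `P(· | u, c ∉ K)`. -/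
theorem HoK_nonneg (hp : IsProbVec p) : 0 ≤ (prob p (TEvent ends a₂ u c) * prob p (PDEvent ends u a₂ c ∩ connEvent ends a₂ o) - prob p (PDEvent ends u a₂ c) * prob p (TEvent ends a₂ u c ∩ connEvent ends a₂ o)) := by
  have h := ToL_mul_D_le p hp ends o a₂ u c
  rw [PDEvent_root_swap ends u a₂ c] at h
  linarith

end Signs

section Reduction

variable (p : E → R) (ends : E → Sym2 V) (o a₂ c b u : V)

omit [Fintype V] [DecidableEq V] in
/-- The masses of `PD` and `T′` vanish when `P₀ = 0`. -/
lemma prob_PD_eq_zero_of_P0 (hp : IsProbVec p)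
    (h0 : prob p (PDEvent ends u a₂ c) + prob p (TEvent ends a₂ u c) = 0) (X : Set (Config E)) :
    prob p (PDEvent ends u a₂ c ∩ X) = 0 ∧ prob p (TEvent ends a₂ u c ∩ X) = 0 := by
  have hD := prob_nonneg hp (PDEvent ends u a₂ c)
  have hT := prob_nonneg hp (TEvent ends a₂ u c)
  have hDX := prob_inter_le_left hp (PDEvent ends u a₂ c) X
  have hTX := prob_inter_le_left hp (TEvent ends a₂ u c) X
  have hDX0 := prob_nonneg hp (PDEvent ends u a₂ c ∩ X)
  have hTX0 := prob_nonneg hp (TEvent ends a₂ u c ∩ X)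
  constructor <;> linarith

/-- **`0 ≤ T2oK` from (MIX-K)**: the single inequality `0 ≤ A·ℋ′ + 2β·X_b` (the mixed-covariance
bound `Cov'(1_{c∈L}·(1_{b∈K} − A/(2β)) − 1_{b∈L}, 1_{o∈K}) ≥ 0` under `P(· | u, c ∉ K)`) implies the
`o ∈ K` half of W1 = `0 ≤ T2`.  Conditional theorem: (MIX-K) is census-true (0 violations, ≈ 3,000
instances n = 5–8, three palettes; an equality on the family «`b` a leaf at `a₂`») and unproved. -/
theorem T2oK_nonneg_of_mixK (hp : IsProbVec p)
    (hmix : 0 ≤ ((prob p (PDEvent ends u a₂ c) * prob p (connEvent ends a₂ b) + prob p (avoidAll ends a₂ {c}) * gap p ends u a₂ b) + (prob p Set.univ * EQb3 p ends u a₂ c b + prob p Set.univ * PDb p ends u a₂ c b + prob p (connEvent ends a₂ b) * EQ3 p ends u a₂ c + prob p (connEvent ends a₂ b) * prob p (avoidAll ends a₂ {u}) - (prob p Set.univ - prob p (avoidAll ends a₂ {c})) * gap p ends u a₂ b)) * (prob p (TEvent ends a₂ u c) * prob p (PDEvent ends u a₂ c ∩ connEvent ends a₂ o) - prob p (PDEvent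 ends u a₂ c) * prob p (TEvent ends a₂ u c ∩ connEvent ends a₂ o)) + 2 * (prob p Set.univ * prob p (PDEvent ends u a₂ c) + prob p (avoidAll ends a₂ {c}) * prob p (avoidAll ends a₂ {u})) * (prob p (TEvent ends a₂ u c ∩ (connEvent ends a₂ o ∩ connEvent ends a₂ b)) * (prob p (PDEvent ends u a₂ c) + prob p (TEvent ends a₂ u c)) - prob p (TEvent ends a₂ u c ∩ connEvent ends a₂ b) * (prob p (PDEvent ends u a₂ c ∩ connEvent ends a₂ o) + prob p (TEvent ends a₂ u c ∩ connEvent ends a₂ o)) - (prob p (PDEvent ends u a₂ c ∩ (connEvent ends a₂ o ∩ connEvent ends u b)) + prob p (TEvent ends a₂ u c ∩ (connEvent ends a₂ o ∩ connEvent ends u b))) * (prob p (PDEvent ends u a₂ c) + prob p (TEvent ends a₂ u c)) + (prob p (PDEvent ends u a₂ c ∩ connEvent ends u b) + prob p (TEvent ends a₂ u c ∩ connEvent ends u b)) * (prob p (PDEvent ends u a₂ c ∩ connEvent ends a₂ o) + prob p (TEvent ends a₂ u c ∩ connEvent ends a₂ o)))) :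
    0 ≤ T2oK p ends o a₂ c b u := by
  have hE := Ee_nonneg p ends a₂ c b u hp
  have h13 := e0P0_sub_d0Po_nonneg p ends o a₂ c u hp
  have hid := P0_mul_T2oK_eq p ends o a₂ c b u
  have hP0 : 0 ≤ (prob p (PDEvent ends u a₂ c) + prob p (TEvent ends a₂ u c)) :=
    add_nonneg (prob_nonneg hp _) (prob_nonneg hp _)
  rcases hP0.lt_or_eq with hpos | hzero
  · have h : 0 ≤ (prob p (PDEvent ends u a₂ c) + prob p (TEvent ends a₂ u c)) * T2oK p ends o a₂ c b u := by
      rw [hid]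
      have := mul_nonneg hE h13
      linarith
    rcases lt_or_ge (T2oK p ends o a₂ c b u) 0 with hneg | hge
    · have := mul_neg_of_pos_of_neg hpos hneg
      linarith
    · exact hge
  · -- `P₀ = 0`: every `PD`/`T′` mass vanishes and `T2oK = ℰ·e0 ≥ 0`
    have hz := hzero.symm
    have he0 := prob_nonneg hp (avoidAll ends a₂ {c} ∩ connEvent ends a₂ o)
    unfold T2oK
    have h1 := prob_PD_eq_zero_of_P0 p ends a₂ c u hp hz (connEvent ends a₂ o)
    have h2 := prob_PD_eq_zero_of_P0 p ends a₂ c u hp hz (connEvent ends a₂ o ∩ connEvent ends a₂ b)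
    have h3 := prob_PD_eq_zero_of_P0 p ends a₂ c u hp hz (connEvent ends a₂ o ∩ connEvent ends u b)
    rw [h1.1, h1.2, h2.2, h3.1, h3.2]
    have := mul_nonneg hE he0
    linarith

end Reduction

end MixK

end RootLeafU

end Summit.Ventures.PercRepro2
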